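import Literature.NumberTheory.EllipticCurves.TwistedHeegnerFamilyExistence
import HarnessLib

/-!
# The sign of the twisting transport under Galois: `σ(θ_C(x)) = χ(σ) · θ_C(σ x)`
# (Silverman X.2 Example 2.4: the cocycle of a quadratic twist is `ξ_σ = [χ(σ)]`,
# `χ(σ) = √d^σ/√d`) — THEOREMS ONLY (no named fact, no claim)

Cross-ladder LITERATURE-TYPING layer (D-0088(4)), cell `bsd-littype`, seat `bsd-littype-06` (gen 4).
Sequel of `TwistedHeegnerTransportGalois.lean` (`σ(θ_C(x)) = θ_{σC}(σx)`, `smul_equiv`) and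
`TwistedHeegnerFamilyExistence.lean` (the explicit twisting transport
`GeomTransport.ofQuadraticTwist`: `C = (C₁)_{K̄}⁻¹ · (u = δ) · (C₀)_{K̄}⁻¹`, `δ = √d ∈ K̄ ∖ ℚ`, with
`C • E′_{K̄} = E_{K̄}` for a `ℚ`-model `E′ = W′` of the quadratic twist `E^{(d)}`, `C₀ • W^{(d)} = W′`).
The module docstring of `TwistedHeegnerModule.lean` records the dictionary the Keller–Yin /
Castella–Hsieh construction rests on — "for `σ ∈ Gal(K[c]/K_n)` one has
`∑_σ σ·θ(P′[c]) = θ(∑_σ χ_ε(σ) σ·P′[c])`: the plain norm of the transported point IS the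
`χ_ε`-component of the Heegner point of `E′`" — as an informal sentence. This file kernel-certifies
it for the tree's explicit transport:

* §1 `GeomTransport.equiv_eq_neg_equiv` — two `K̄`-isomorphisms `E′_{K̄} ≅ E_{K̄}` given by changes
  of variables `C = (u, r, s, t)`, `C′ = (−u, r, s′, t′)` differ by the sign: `θ_{C′} = −θ_C`
  (the `a₁`, `a₃` coefficients of `C • E′ = C′ • E′ = E` force `s′ = −a₁′ − s`, `2t′ = …`; then
  Silverman III.2.3: `−(x, y) = (x, −y − a₁x − a₃)`).
* §2 For `T = ofQuadraticTwist …` and `σ ∈ Γ_K`: `σδ = ±δ` (`smul_eq_or_smul_eq_neg_of_sq_eq`);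
  if `σδ = −δ` then `σC = (C₁)⁻¹ (u = −δ) (C₀)⁻¹` (`ofQuadraticTwist_mapGal_of_smul_eq_neg`), which
  has `u ↦ −u`, `r ↦ r`, hence **`σ(θ_C(x)) = −θ_C(σx)`** (`smul_equiv_ofQuadraticTwist_of_smul_eq_neg`);
  if `σδ = δ` then `σ(θ_C(x)) = θ_C(σx)` (gen-4 `ofQuadraticTwist_C_map_eq`). Together:
  **`σ(θ_C(x)) = χ(σ) · θ_C(σx)`** with `χ(σ) = genusSign δ σ ∈ ℤˣ` the sign cocycle of `√d`
  (`RingClassGenusCharacter.lean`) — Silverman X.2 Example 2.4: the cocycle of the quadratic twist is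
  `ξ_σ = φ^σ φ⁻¹ = [χ(σ)]` (`smul_equiv_ofQuadraticTwist`).
* §3 The dictionary: `∑_{r ∈ R} r·θ_C(x) = θ_C(∑_{r ∈ R} χ(r) r·x)` for every finite `R ⊆ Γ_K`
  (`sum_smul_equiv_ofQuadraticTwist`) — the norm points `z_j` of a `TwistedHeegnerFamily` built on
  `ofQuadraticTwist` (gen-4 `nonempty_twistedHeegnerFamily_of`) are the transports of the
  `χ`-twisted norms of the Heegner points of `E′`.

Nothing is asserted beyond these proved identities (0 named facts, 0 claims).

## References

* [SilvermanAEC2009] X.2 Thm. 2.2 (proof: `φ^σ = ξ_σ φ`) and X.2 Example 2.4 (PDF p. 276–277: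
  `χ(σ) = √d^σ/√d`, `ξ_σ = [χ(σ)]`, "`dy′² = f(x′)` … isomorphic to `E` over `K(√d)`" via
  `(x′, y′) ↦ (x′, y′√d)`, "the associated cocycle is `ξ`"); III.2.3 (the negation formula);
  III.1 Table 3.1 (substitution formulas).
* Keller–Yin, arXiv:2410.23241v1, proof of Thm. 3.3.5 (p0018–p0019: "their `χ` is our `χ_ε`") —
  context only; nothing of it is used or asserted here.
-/

set_option autoImplicit false

noncomputable section

open scoped Classical

universe u

namespace Literature.NumberTheory.EllipticCurves

open WeierstrassCurve

/-! ### §1 Transports with `u′ = −u`, `r′ = r` differ by the sign -/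

namespace GeomTransport

variable {W' W : WeierstrassCurve ℚ} {K : Type u} [Field K] [NumberField K]

/-- **`θ_{C′} = −θ_C` when `C′ = (−u, r, s′, t′)`, `C = (u, r, s, t)` both carry `E′_{K̄}` to
`E_{K̄}`.** Comparing the `a₁` and `a₃` coefficients of `C • E′ = E = C′ • E′` (Silverman III.1
Table 3.1: `a₁(E) = u⁻¹(a₁(E′) + 2s)`, `a₃(E) = u⁻³(a₃(E′) + r a₁(E′) + 2t)`) gives
`u⁻¹(s′ − s) = −a₁(E)` and `u⁻³(t′ − t) = −a₃(E)` (characteristic `0`), whence on coordinates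
`(u⁻²(x − r), (−u)⁻³(y − s′(x − r) − t′)) = (x_C, −y_C − a₁(E) x_C − a₃(E))`, the negative of
`θ_C(x, y) = (x_C, y_C)` (III.2.3). [cite: SilvermanAEC2009, III.2.3 (negation formula) and III.1 Table 3.1] -/
theorem equiv_eq_neg_equiv (T T' : GeomTransport W' W K) (hu : T'.C.u = -T.C.u)
    (hr : T'.C.r = T.C.r) (x : geomPoints (W'.baseChange K)) : T'.equiv x = -T.equiv x := by
  have h1 := congrArg WeierstrassCurve.a₁ T.smul_eq
  have h1' := congrArg WeierstrassCurve.a₁ T'.smul_eq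
  have h3 := congrArg WeierstrassCurve.a₃ T.smul_eq
  have h3' := congrArg WeierstrassCurve.a₃ T'.smul_eq
  rw [variableChange_a₁] at h1 h1'
  rw [variableChange_a₃] at h3 h3'
  -- `(−u)⁻¹ = −u⁻¹`
  have hui : ((T'.C.u⁻¹ : (AlgebraicClosure K)ˣ) : AlgebraicClosure K) =
      -((T.C.u⁻¹ : (AlgebraicClosure K)ˣ) : AlgebraicClosure K) := by
    rw [Units.val_inv_eq_inv_val, Units.val_inv_eq_inv_val, hu, Units.val_neg, ← neg_inv]
  rw [hui] at h1'
  rw [hui, hr] at h3'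
  set ui := ((T.C.u⁻¹ : (AlgebraicClosure K)ˣ) : AlgebraicClosure K) with hui_def
  -- `u⁻¹(s′ − s) = −a₁(E)`, `u⁻³(t′ − t) = −a₃(E)` (cancel the `2`: characteristic `0`)
  have h2 : (2 : AlgebraicClosure K) ≠ 0 := two_ne_zero
  have hS : ui * (T'.C.s - T.C.s) = -((W.baseChange K).baseChange (AlgebraicClosure K)).a₁ := by
    have h0 : (2 : AlgebraicClosure K) *
        (ui * (T'.C.s - T.C.s) + ((W.baseChange K).baseChange (AlgebraicClosure K)).a₁) = 0 := by
      linear_combination -h1 - h1'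
    exact eq_neg_of_add_eq_zero_left ((mul_eq_zero.mp h0).resolve_left h2)
  have hT : ui ^ 3 * (T'.C.t - T.C.t) = -((W.baseChange K).baseChange (AlgebraicClosure K)).a₃ := by
    have h0 : (2 : AlgebraicClosure K) *
        (ui ^ 3 * (T'.C.t - T.C.t) + ((W.baseChange K).baseChange (AlgebraicClosure K)).a₃) = 0 := by
      linear_combination -h3 - h3'
    exact eq_neg_of_add_eq_zero_left ((mul_eq_zero.mp h0).resolve_left h2)
  cases x with
  | zero =>
    change T'.equiv 0 = -T.equiv 0
    rw [map_zero, map_zero, neg_zero]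
  | @some a b h =>
    change T'.equiv (.some a b h) = -T.equiv (.some a b h)
    rw [T'.equiv_some h, T.equiv_some h]
    change (Affine.Point.some (T'.C.toX a) (T'.C.toY a b) _ :
        ((W.baseChange K).baseChange (AlgebraicClosure K)).toAffine.Point) =
      -Affine.Point.some (T.C.toX a) (T.C.toY a b) _
    rw [Affine.Point.neg_some, Affine.Point.some.injEq]
    refine ⟨?_, ?_⟩
    · rw [VariableChange.toX_def, VariableChange.toX_def, hui, hr, neg_sq]
    · rw [VariableChange.toY_def, VariableChange.toY_def, VariableChange.toX_def, Affine.negY, hui,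
        hr]
      linear_combination (ui ^ 2 * (a - T.C.r)) * hS + hT

/-- Two transports with the same change of variables are equal (the other field is a proof).
[cite: SilvermanAEC2009, III.3.1(b)] -/
theorem ext_C {T T' : GeomTransport W' W K} (h : T.C = T'.C) : T = T' := by
  obtain ⟨C, hC⟩ := T
  obtain ⟨C', hC'⟩ := T'
  simp only at h
  subst h
  rfl

end GeomTransport

/-! ### §2 The twisting transport: `σ(θ_C(x)) = χ(σ) θ_C(σx)` -/

section Twist

variable {K : Type u} [Field K] [NumberField K]

variable (W W' : WeierstrassCurve ℚ) {d : ℚ} {C₁ C₀ : VariableChange ℚ} {δ : AlgebraicClosure K}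

/-- `−δ ∉ ℚ` when `δ ∉ ℚ`. [cite: HardyWright2008, §4.3 Thm. 44] -/
theorem neg_not_mem_range_algebraMap (hδ : δ ∉ Set.range (algebraMap ℚ (AlgebraicClosure K))) :
    -δ ∉ Set.range (algebraMap ℚ (AlgebraicClosure K)) := by
  rintro ⟨q, hq⟩
  exact hδ ⟨-q, by rw [map_neg, hq, neg_neg]⟩

/-- `σδ = δ` or `σδ = −δ` for every `σ ∈ Γ_K` and every square root `δ ∈ K̄` of a rational number
(`(σδ)² = δ²`; the tree's `algEquiv_apply_eq_or_eq_neg_of_sq_eq` over `K`). Silverman X.2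
Example 2.4: `√d^σ = χ(σ)√d`, `χ(σ) ∈ {±1}`. [cite: SilvermanAEC2009, X.2 Example 2.4] -/
theorem smul_eq_or_smul_eq_neg_of_sq_eq (hδ2 : δ ^ 2 = algebraMap ℚ (AlgebraicClosure K) d)
    (σ : Field.absoluteGaloisGroup K) : σ • δ = δ ∨ σ • δ = -δ := by
  have h2 : δ ^ 2 = algebraMap K (AlgebraicClosure K) (algebraMap ℚ K d) := by
    rw [hδ2, IsScalarTower.algebraMap_apply ℚ K (AlgebraicClosure K)]
  exact algEquiv_apply_eq_or_eq_neg_of_sq_eq h2 (Field.absoluteGaloisGroup.toAlgEquiv K σ)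

/-- A square root `δ ∉ ℚ` satisfies `δ ≠ −δ` (`δ ≠ 0`, characteristic `0`).
[cite: HardyWright2008, §4.3 Thm. 44] -/
theorem ne_neg_self_of_not_mem_range (hδ : δ ∉ Set.range (algebraMap ℚ (AlgebraicClosure K))) :
    δ ≠ -δ := by
  intro h0
  have hδ0 : δ ≠ 0 :=
    Literature.NumberTheory.QuadraticFields.Quadratic.ne_zero_of_not_mem_range hδ
  have h2 : (2 : AlgebraicClosure K) * δ = 0 := by linear_combination h0
  exact hδ0 ((mul_eq_zero.mp h2).resolve_left two_ne_zero)

omit [NumberField K] in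
/-- For `σ ∈ Γ_K`: `χ(σ) = 1` iff `σδ = δ` (unfolding of `genusSign` at `toAlgEquiv K σ`).
[cite: SilvermanAEC2009, X.2 Example 2.4] -/
theorem genusSign_toAlgEquiv_eq_one_iff (σ : Field.absoluteGaloisGroup K) :
    genusSign δ (Field.absoluteGaloisGroup.toAlgEquiv K σ) = 1 ↔ σ • δ = δ :=
  genusSign_eq_one_iff δ _

/-- For `σ ∈ Γ_K` and a square root `δ ∉ ℚ` of a rational number: `χ(σ) = −1` iff `σδ = −δ`.
[cite: SilvermanAEC2009, X.2 Example 2.4] -/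
theorem genusSign_toAlgEquiv_eq_neg_one_iff (hδ : δ ∉ Set.range (algebraMap ℚ (AlgebraicClosure K)))
    (hδ2 : δ ^ 2 = algebraMap ℚ (AlgebraicClosure K) d) (σ : Field.absoluteGaloisGroup K) :
    genusSign δ (Field.absoluteGaloisGroup.toAlgEquiv K σ) = -1 ↔ σ • δ = -δ := by
  have h2 : δ ^ 2 = algebraMap K (AlgebraicClosure K) (algebraMap ℚ K d) := by
    rw [hδ2, IsScalarTower.algebraMap_apply ℚ K (AlgebraicClosure K)]
  exact genusSign_eq_neg_one_iff h2 (ne_neg_self_of_not_mem_range hδ) _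

/-- A change of variables defined over `ℚ` is fixed by every ring endomorphism of `K̄` (ring maps fix
`ℚ`; Mathlib `RingHom.ext_rat`). [folklore] -/
private theorem variableChange_map_rat_map_eq' (C : VariableChange ℚ)
    (g : AlgebraicClosure K →+* AlgebraicClosure K) :
    (C.map (algebraMap ℚ (AlgebraicClosure K))).map g = C.map (algebraMap ℚ (AlgebraicClosure K)) := by
  rw [VariableChange.map_map, RingHom.ext_rat (g.comp (algebraMap ℚ (AlgebraicClosure K)))
    (algebraMap ℚ (AlgebraicClosure K))]

/-- A ring endomorphism `g` of `K̄` with `g δ = −δ` carries the untwisting substitution `(u = δ)` to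
`(u = −δ)`. [cite: SilvermanAEC2009, X.2 Example 2.4] -/
theorem twistUntwist_map_eq_of_map_eq_neg
    (hδ : δ ∉ Set.range (algebraMap ℚ (AlgebraicClosure K)))
    {g : AlgebraicClosure K →+* AlgebraicClosure K} (hg : g δ = -δ) :
    (twistUntwist hδ).map g = twistUntwist (neg_not_mem_range_algebraMap hδ) := by
  simp only [twistUntwist, VariableChange.map, map_zero, VariableChange.mk.injEq, and_true]
  ext
  simp [hg]

/-- **`σC` for `σδ = −δ`**: a ring endomorphism `g` of `K̄` with `g δ = −δ` carries the twisting
transport's change of variables `C = (C₁)⁻¹ (u = δ) (C₀)⁻¹` to `(C₁)⁻¹ (u = −δ) (C₀)⁻¹` (the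
`ℚ`-rational factors are fixed). Silverman X.2 Example 2.4 (`√d^σ = χ(σ)√d`).
[cite: SilvermanAEC2009, X.2 Example 2.4 and X.2 Thm. 2.2 (proof: φ^σ)] -/
theorem GeomTransport.ofQuadraticTwist_C_map_eq_of_map_eq_neg (hC₁ : C₁ • W = W.quadraticTwist 1)
    (hW : C₀ • W.quadraticTwist d = W') (hδ : δ ∉ Set.range (algebraMap ℚ (AlgebraicClosure K)))
    (hδ2 : δ ^ 2 = algebraMap ℚ (AlgebraicClosure K) d)
    {g : AlgebraicClosure K →+* AlgebraicClosure K} (hg : g δ = -δ) :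
    (GeomTransport.ofQuadraticTwist W W' hC₁ hW hδ hδ2).C.map g =
      (GeomTransport.ofQuadraticTwist W W' hC₁ hW (neg_not_mem_range_algebraMap hδ)
        ((neg_sq δ).trans hδ2)).C := by
  rw [GeomTransport.ofQuadraticTwist_C, GeomTransport.ofQuadraticTwist_C]
  change VariableChange.mapHom g _ = _
  rw [map_mul, map_mul, map_inv, map_inv]
  change ((C₁.map _).map g)⁻¹ * (twistUntwist hδ).map g * ((C₀.map _).map g)⁻¹ = _
  rw [variableChange_map_rat_map_eq', variableChange_map_rat_map_eq',
    twistUntwist_map_eq_of_map_eq_neg hδ hg]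

/-- **The conjugate of the twisting transport by `σ` with `σδ = −δ` is the transport built on `−δ`**
(`θ_C^σ = θ_{σC}`, `TwistedHeegnerTransportGalois.mapGal`).
[cite: SilvermanAEC2009, X.2 Thm. 2.2 (proof: φ^σ) and X.2 Example 2.4] -/
theorem GeomTransport.ofQuadraticTwist_mapGal_of_smul_eq_neg (hC₁ : C₁ • W = W.quadraticTwist 1)
    (hW : C₀ • W.quadraticTwist d = W') (hδ : δ ∉ Set.range (algebraMap ℚ (AlgebraicClosure K)))
    (hδ2 : δ ^ 2 = algebraMap ℚ (AlgebraicClosure K) d) {σ : Field.absoluteGaloisGroup K}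
    (hσ : σ • δ = -δ) :
    (GeomTransport.ofQuadraticTwist W W' hC₁ hW hδ hδ2).mapGal σ =
      GeomTransport.ofQuadraticTwist W W' hC₁ hW (neg_not_mem_range_algebraMap hδ)
        ((neg_sq δ).trans hδ2) := by
  apply GeomTransport.ext_C
  rw [GeomTransport.mapGal_C]
  exact GeomTransport.ofQuadraticTwist_C_map_eq_of_map_eq_neg W W' hC₁ hW hδ hδ2 hσ

/-- The change of variables of the transport built on `−δ` has scaling `−u`, `u` that of the
transport built on `δ`. [cite: SilvermanAEC2009, X.2 Example 2.4] -/
theorem GeomTransport.ofQuadraticTwist_neg_C_u (hC₁ : C₁ • W = W.quadraticTwist 1)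
    (hW : C₀ • W.quadraticTwist d = W') (hδ : δ ∉ Set.range (algebraMap ℚ (AlgebraicClosure K)))
    (hδ2 : δ ^ 2 = algebraMap ℚ (AlgebraicClosure K) d) :
    (GeomTransport.ofQuadraticTwist W W' hC₁ hW (neg_not_mem_range_algebraMap hδ)
        ((neg_sq δ).trans hδ2)).C.u =
      -(GeomTransport.ofQuadraticTwist W W' hC₁ hW hδ hδ2).C.u := by
  ext
  simp only [GeomTransport.ofQuadraticTwist_C, VariableChange.mul_def, VariableChange.inv_def,
    twistUntwist, Units.val_mul, Units.val_neg, Units.val_mk0]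
  ring

/-- The change of variables of the transport built on `−δ` has the same translation `r` as the
one built on `δ` (`r` involves only `δ² = d`). [cite: SilvermanAEC2009, X.2 Example 2.4] -/
theorem GeomTransport.ofQuadraticTwist_neg_C_r (hC₁ : C₁ • W = W.quadraticTwist 1)
    (hW : C₀ • W.quadraticTwist d = W') (hδ : δ ∉ Set.range (algebraMap ℚ (AlgebraicClosure K)))
    (hδ2 : δ ^ 2 = algebraMap ℚ (AlgebraicClosure K) d) :
    (GeomTransport.ofQuadraticTwist W W' hC₁ hW (neg_not_mem_range_algebraMap hδ)
        ((neg_sq δ).trans hδ2)).C.r =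
      (GeomTransport.ofQuadraticTwist W W' hC₁ hW hδ hδ2).C.r := by
  simp only [GeomTransport.ofQuadraticTwist_C, VariableChange.mul_def, VariableChange.inv_def,
    twistUntwist, Units.val_mk0, neg_sq]

/-- **`σ(θ_C(x)) = −θ_C(σx)` when `σ√d = −√d`** for the twisting transport
`θ_C : E′_{K̄} ≅ E_{K̄}` (`GeomTransport.ofQuadraticTwist`): `σ(θ_C(x)) = θ_{σC}(σx)` (`smul_equiv`),
`σC = (C₁)⁻¹(u = −δ)(C₀)⁻¹` has `u ↦ −u`, `r ↦ r`, and §1. Silverman X.2 Example 2.4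
(`y^σ = χ(σ) y`: the cocycle of the quadratic twist is `[χ(σ)]`).
[cite: SilvermanAEC2009, X.2 Example 2.4 (ξ_σ = [χ(σ)], χ(σ) = √d^σ/√d)] -/
theorem GeomTransport.smul_equiv_ofQuadraticTwist_of_smul_eq_neg (hC₁ : C₁ • W = W.quadraticTwist 1)
    (hW : C₀ • W.quadraticTwist d = W') (hδ : δ ∉ Set.range (algebraMap ℚ (AlgebraicClosure K)))
    (hδ2 : δ ^ 2 = algebraMap ℚ (AlgebraicClosure K) d) {σ : Field.absoluteGaloisGroup K}
    (hσ : σ • δ = -δ) (x : geomPoints (W'.baseChange K)) :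
    σ • (GeomTransport.ofQuadraticTwist W W' hC₁ hW hδ hδ2).equiv x =
      -(GeomTransport.ofQuadraticTwist W W' hC₁ hW hδ hδ2).equiv (σ • x) := by
  rw [GeomTransport.smul_equiv, GeomTransport.ofQuadraticTwist_mapGal_of_smul_eq_neg W W' hC₁ hW hδ
    hδ2 hσ]
  exact GeomTransport.equiv_eq_neg_equiv _ _
    (GeomTransport.ofQuadraticTwist_neg_C_u W W' hC₁ hW hδ hδ2)
    (GeomTransport.ofQuadraticTwist_neg_C_r W W' hC₁ hW hδ hδ2) _

/-- **`σ(θ_C(x)) = θ_C(σx)` when `σ√d = √d`** (gen-4 `ofQuadraticTwist_C_map_eq` with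
`smul_equiv_of_map_eq`). [cite: SilvermanAEC2009, X.2 Thm. 2.2 (proof) and X.2 Example 2.4] -/
theorem GeomTransport.smul_equiv_ofQuadraticTwist_of_smul_eq (hC₁ : C₁ • W = W.quadraticTwist 1)
    (hW : C₀ • W.quadraticTwist d = W') (hδ : δ ∉ Set.range (algebraMap ℚ (AlgebraicClosure K)))
    (hδ2 : δ ^ 2 = algebraMap ℚ (AlgebraicClosure K) d) {σ : Field.absoluteGaloisGroup K}
    (hσ : σ • δ = δ) (x : geomPoints (W'.baseChange K)) :
    σ • (GeomTransport.ofQuadraticTwist W W' hC₁ hW hδ hδ2).equiv x =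
      (GeomTransport.ofQuadraticTwist W W' hC₁ hW hδ hδ2).equiv (σ • x) :=
  GeomTransport.smul_equiv_of_map_eq _
    (GeomTransport.ofQuadraticTwist_C_map_eq W W' hC₁ hW hδ hδ2 hσ) x

/-- **The cocycle of the twisting transport is the quadratic character:
`σ(θ_C(x)) = χ(σ) · θ_C(σx)`** for every `σ ∈ Γ_K` and `x ∈ E′(K̄)`, with
`χ(σ) = genusSign δ σ = δ^σ/δ ∈ ℤˣ = Aut` generic (`RingClassGenusCharacter.lean`). Silverman X.2
Example 2.4: "the associated cocycle is `ξ`", `ξ_σ = [χ(σ)]`, `χ(σ) = √d^σ/√d`, for the curve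
`dy′² = f(x′)` identified with `E` by `(x′, y′) ↦ (x′, y′√d)` over `K(√d)` — here for the tree's
explicit `ℚ`-models and substitution `C = (C₁)⁻¹(u = √d)(C₀)⁻¹`.
[cite: SilvermanAEC2009, X.2 Example 2.4 (ξ_σ = [χ(σ)]) and X.2 Thm. 2.2 (proof: φ^σ = ξ_σ φ)] -/
theorem GeomTransport.smul_equiv_ofQuadraticTwist (hC₁ : C₁ • W = W.quadraticTwist 1)
    (hW : C₀ • W.quadraticTwist d = W') (hδ : δ ∉ Set.range (algebraMap ℚ (AlgebraicClosure K)))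
    (hδ2 : δ ^ 2 = algebraMap ℚ (AlgebraicClosure K) d) (σ : Field.absoluteGaloisGroup K)
    (x : geomPoints (W'.baseChange K)) :
    σ • (GeomTransport.ofQuadraticTwist W W' hC₁ hW hδ hδ2).equiv x =
      ((genusSign δ (Field.absoluteGaloisGroup.toAlgEquiv K σ) : ℤˣ) : ℤ) •
        (GeomTransport.ofQuadraticTwist W W' hC₁ hW hδ hδ2).equiv (σ • x) := by
  rcases smul_eq_or_smul_eq_neg_of_sq_eq hδ2 σ with h | h
  · rw [(genusSign_toAlgEquiv_eq_one_iff σ).mpr h, Units.val_one, one_smul]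
    exact GeomTransport.smul_equiv_ofQuadraticTwist_of_smul_eq W W' hC₁ hW hδ hδ2 h x
  · rw [(genusSign_toAlgEquiv_eq_neg_one_iff hδ hδ2 σ).mpr h, Units.val_neg, Units.val_one,
      neg_smul, one_smul]
    exact GeomTransport.smul_equiv_ofQuadraticTwist_of_smul_eq_neg W W' hC₁ hW hδ hδ2 h x

/-! ### §3 The dictionary: plain norms of transported points = transports of `χ`-twisted norms -/

/-- **`∑_{r ∈ R} r·θ_C(x) = θ_C(∑_{r ∈ R} χ(r) r·x)`** for every finite set `R ⊆ Γ_K` of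
automorphisms and `x ∈ E′(K̄)`: the plain "norm" over `R` of the transported point is the transport
of the `χ`-twisted norm (`θ_C` is additive; §2). With `R` a transversal of `Gal(K[p^{j+1}]/K_j)` and
`x = P′[p^{j+1}]` a Heegner point of `E′` this is the sentence of `TwistedHeegnerModule.lean`'s
docstring "`∑_σ σ·θ(P′[c]) = θ(∑_σ χ_ε(σ) σ·P′[c])`" for the families produced by
`nonempty_twistedHeegnerFamily_of` (there `χ = genusSign √p*`, the character of `K(√p*)/K`).
[cite: SilvermanAEC2009, X.2 Example 2.4 (ξ_σ = [χ(σ)])] -/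
theorem GeomTransport.sum_smul_equiv_ofQuadraticTwist (hC₁ : C₁ • W = W.quadraticTwist 1)
    (hW : C₀ • W.quadraticTwist d = W') (hδ : δ ∉ Set.range (algebraMap ℚ (AlgebraicClosure K)))
    (hδ2 : δ ^ 2 = algebraMap ℚ (AlgebraicClosure K) d) (R : Finset (Field.absoluteGaloisGroup K))
    (x : geomPoints (W'.baseChange K)) :
    ∑ r ∈ R, r • (GeomTransport.ofQuadraticTwist W W' hC₁ hW hδ hδ2).equiv x =
      (GeomTransport.ofQuadraticTwist W W' hC₁ hW hδ hδ2).equiv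
        (∑ r ∈ R, ((genusSign δ (Field.absoluteGaloisGroup.toAlgEquiv K r) : ℤˣ) : ℤ) • (r • x)) := by
  rw [map_sum]
  refine Finset.sum_congr rfl fun r _ ↦ ?_
  rw [map_zsmul, GeomTransport.smul_equiv_ofQuadraticTwist]

/-- **Conversely `θ_C(∑_{r ∈ R} r·x) = ∑_{r ∈ R} χ(r) r·θ_C(x)`**: the transport of the plain norm is
the `χ`-twisted norm of the transported point (`χ(r)² = 1`).
[cite: SilvermanAEC2009, X.2 Example 2.4 (ξ_σ = [χ(σ)])] -/
theorem GeomTransport.equiv_sum_smul_ofQuadraticTwist (hC₁ : C₁ • W = W.quadraticTwist 1)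
    (hW : C₀ • W.quadraticTwist d = W') (hδ : δ ∉ Set.range (algebraMap ℚ (AlgebraicClosure K)))
    (hδ2 : δ ^ 2 = algebraMap ℚ (AlgebraicClosure K) d) (R : Finset (Field.absoluteGaloisGroup K))
    (x : geomPoints (W'.baseChange K)) :
    (GeomTransport.ofQuadraticTwist W W' hC₁ hW hδ hδ2).equiv (∑ r ∈ R, r • x) =
      ∑ r ∈ R, ((genusSign δ (Field.absoluteGaloisGroup.toAlgEquiv K r) : ℤˣ) : ℤ) •
        (r • (GeomTransport.ofQuadraticTwist W W' hC₁ hW hδ hδ2).equiv x) := by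
  rw [map_sum]
  refine Finset.sum_congr rfl fun r _ ↦ ?_
  rw [GeomTransport.smul_equiv_ofQuadraticTwist, smul_smul, ← Units.val_mul, Int.units_mul_self,
    Units.val_one, one_smul]

end Twist

/-! ### §4 The norm points of a twisted Heegner family built on the twisting transport -/

section HeegnerGeom

open ModularForms

variable {N' : ℕ} [NeZero N'] (W W' : WeierstrassCurve ℚ) {K : Type u} [Field K] [NumberField K]
  {p : ℕ} [Fact p.Prime] {d : ℚ} {C₁ C₀ : VariableChange ℚ} {δ : AlgebraicClosure K}

/-- **`z = θ_C(∑_{r ∈ R} χ(r) r·P′[c])`**: a norm point `z = ∑_{r ∈ R} r·θ_C(P′[c])` to the layer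
`K_n` of a transported Heegner point of conductor `c` (`IsTwistedHeegnerNormPoint`, transport
`θ_C = GeomTransport.ofQuadraticTwist …`) IS the transport of the `χ`-twisted norm
`∑_{r ∈ R} χ(r) r·P′[c]` of the Heegner point `P′[c] = x′` of `E′`, `χ = genusSign √d` the quadratic
character of `K(√d)/K` and `R` the transversal of `Gal(K̄/K[c])` in `Gal(K̄/K_n)` of the definition —
the sentence "`∑_σ σ·θ(P′[c]) = θ(∑_σ χ_ε(σ) σ·P′[c])`" of `TwistedHeegnerModule.lean`'s docstring,
now a theorem (§3). [cite: SilvermanAEC2009, X.2 Example 2.4 (ξ_σ = [χ(σ)])]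
[cite: CastellaHsieh2018, §4.4 (the χ-components of the Heegner classes)] -/
theorem IsTwistedHeegnerNormPoint.exists_eq_equiv_sum_genusSign_smul
    (hC₁ : C₁ • W = W.quadraticTwist 1) (hW : C₀ • W.quadraticTwist d = W')
    (hδ : δ ∉ Set.range (algebraMap ℚ (AlgebraicClosure K)))
    (hδ2 : δ ^ 2 = algebraMap ℚ (AlgebraicClosure K) d) {κ : ZpExtension K p}
    {Dt' : ModularParametrizationData W' N'} {β : ℤ} {jbar : AlgebraicClosure K →+* ℂ} {n c : ℕ}
    {z : geomPoints (W.baseChange K)}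
    (h : IsTwistedHeegnerNormPoint N' W W' K κ Dt' β
      (GeomTransport.ofQuadraticTwist W W' hC₁ hW hδ hδ2) jbar n c z) :
    ∃ (x' : geomPoints (W'.baseChange K)) (R : Finset (Field.absoluteGaloisGroup K)),
      IsHeegnerGeomPoint N' W' K Dt' β c jbar x' ∧
      (∀ σ ∈ ringClassSubgroup K c jbar, σ • x' = x') ∧
      (↑R ⊆ (κ.layerSubgroup n : Set (Field.absoluteGaloisGroup K))) ∧
      (∀ τ ∈ κ.layerSubgroup n, ∃! r, r ∈ R ∧ r⁻¹ * τ ∈ ringClassSubgroup K c jbar) ∧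
      z = (GeomTransport.ofQuadraticTwist W W' hC₁ hW hδ hδ2).equiv
        (∑ r ∈ R, ((genusSign δ (Field.absoluteGaloisGroup.toAlgEquiv K r) : ℤˣ) : ℤ) •
          (r • x')) := by
  obtain ⟨x', R, hx', hfix, -, hRsub, htrans, rfl⟩ := h
  exact ⟨x', R, hx', hfix, hRsub, htrans,
    GeomTransport.sum_smul_equiv_ofQuadraticTwist W W' hC₁ hW hδ hδ2 R x'⟩

/-- **The norm points `z_j` of a twisted Heegner family whose transport is the twisting transport
are the transports of the `χ`-twisted norms `∑_{r} χ(r) r·P′[p^{j+1}]` of the Heegner points of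
`E′`** (the families of `nonempty_twistedHeegnerFamily_of` are of this kind, `χ = genusSign √p*`).
[cite: SilvermanAEC2009, X.2 Example 2.4 (ξ_σ = [χ(σ)])]
[cite: CastellaHsieh2018, §4.4 (the χ-components of the Heegner classes)] -/
theorem TwistedHeegnerFamily.exists_z_eq_equiv_sum_genusSign_smul
    (hC₁ : C₁ • W = W.quadraticTwist 1) (hW : C₀ • W.quadraticTwist d = W')
    (hδ : δ ∉ Set.range (algebraMap ℚ (AlgebraicClosure K)))
    (hδ2 : δ ^ 2 = algebraMap ℚ (AlgebraicClosure K) d) {κ : ZpExtension K p}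
    {jbar : AlgebraicClosure K →+* ℂ} (F : TwistedHeegnerFamily N' W W' K κ jbar)
    (hT : F.T = GeomTransport.ofQuadraticTwist W W' hC₁ hW hδ hδ2) (j : ℕ) :
    ∃ (x' : geomPoints (W'.baseChange K)) (R : Finset (Field.absoluteGaloisGroup K)),
      IsHeegnerGeomPoint N' W' K F.Dt F.β (p ^ (j + 1)) jbar x' ∧
      (∀ σ ∈ ringClassSubgroup K (p ^ (j + 1)) jbar, σ • x' = x') ∧
      (↑R ⊆ (κ.layerSubgroup j : Set (Field.absoluteGaloisGroup K))) ∧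
      (∀ τ ∈ κ.layerSubgroup j, ∃! r, r ∈ R ∧ r⁻¹ * τ ∈ ringClassSubgroup K (p ^ (j + 1)) jbar) ∧
      F.z j = F.T.equiv
        (∑ r ∈ R, ((genusSign δ (Field.absoluteGaloisGroup.toAlgEquiv K r) : ℤˣ) : ℤ) •
          (r • x')) := by
  have h := F.isTwistedHeegnerNormPoint_z j
  rw [hT] at h ⊢
  exact IsTwistedHeegnerNormPoint.exists_eq_equiv_sum_genusSign_smul W W' hC₁ hW hδ hδ2 h

end HeegnerGeom

/-! ### §5 Existence with the transport exposed, and the dictionary for the families it yields -/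

section ExistenceSign

open ModularForms

variable {K : Type} [Field K] [NumberField K] {N' : ℕ} [NeZero N'] {W W' : WeierstrassCurve ℚ}
  {p : ℕ} [Fact p.Prime]

/-- **Twisted Heegner families ON THE TWISTING TRANSPORT exist** — the existence theorem
`nonempty_twistedHeegnerFamily_of` (gen 4, `TwistedHeegnerFamilyExistence.lean`) with its witness
EXPOSED: under the same hypotheses (`E′ = W′` a `ℚ`-model of `E^{(p*)}`, `p` odd, `p ∤ N′ d_K`,
Heegner hypothesis; CONDITIONAL on the refereed facts `exists_isHeegnerNormPoint N′ W′ K p` and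
`sqrt_pStar_mem_ringClassField`) there are a square root `δ = √p* ∈ K̄ ∖ ℚ`, a completed-square
substitution `C₁ • W = W^{(1)}` and a family with the GIVEN `Dt′`, `β` whose transport IS
`GeomTransport.ofQuadraticTwist W W′ hC₁ hW hδ hδ2`. Same proof, verbatim, returning the witness.
[cite: Howard2004HeegnerKolyvagin, §2.7 and §3.3 (P[m] ∈ E(K[m]); P_k = Norm P[p^{k+1}])]
[cite: SilvermanAEC2009, X.2 Example 2.4 and X.5 (quadratic twists)] -/
theorem exists_twistedHeegnerFamily_T_eq_ofQuadraticTwist [W'.IsElliptic]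
    (hH : exists_isHeegnerNormPoint N' W' K p) (hG : sqrt_pStar_mem_ringClassField)
    (hK : IsImaginaryQuadratic K) (hHN : SatisfiesHeegnerHypothesis N' K) (hpN : ¬ p ∣ N')
    (hp2 : p ≠ 2) (hpd : ¬ (p : ℤ) ∣ NumberField.discr K) {C₀ : VariableChange ℚ}
    (hW : C₀ • W.quadraticTwist ((-1 : ℚ) ^ (p / 2) * p) = W') (κ : ZpExtension K p)
    (Dt : ModularParametrizationData W' N') {β : ℤ}
    (hβ : (4 * N' : ℤ) ∣ β ^ 2 - NumberField.discr K) (jbar : AlgebraicClosure K →+* ℂ) :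
    ∃ (δ : AlgebraicClosure K) (hδ : δ ∉ Set.range (algebraMap ℚ (AlgebraicClosure K)))
      (hδ2 : δ ^ 2 = algebraMap ℚ (AlgebraicClosure K) ((-1 : ℚ) ^ (p / 2) * p))
      (C₁ : VariableChange ℚ) (hC₁ : C₁ • W = W.quadraticTwist 1)
      (F : TwistedHeegnerFamily N' W W' K κ jbar),
      F.Dt = Dt ∧ F.β = β ∧ F.T = GeomTransport.ofQuadraticTwist W W' hC₁ hW hδ hδ2 := by
  have hp : p.Prime := Fact.out
  -- a square root `δ` of `p*` in `K̄`, from the genus datum `θ = √p* ∈ K[p] ⊆ ℂ`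
  obtain ⟨θ, hθ2, -⟩ := hG K hK (jbar.comp (algebraMap K (AlgebraicClosure K))) p hp hp2 hpd
  obtain ⟨δ, hδθ⟩ : (θ : ℂ) ∈ Set.range jbar :=
    mem_range_of_mem_ringClassField hK jbar hp.ne_zero θ.2
  have hδ2 : δ ^ 2 = algebraMap ℚ (AlgebraicClosure K) ((-1 : ℚ) ^ (p / 2) * p) := by
    have hθ2' : ((θ : ℂ)) ^ 2 = (((-1 : ℚ) ^ (p / 2) * p : ℚ) : ℂ) := by
      have := congrArg Subtype.val hθ2
      simpa using this
    apply jbar.injective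
    rw [map_pow, hδθ, hθ2']
    exact (map_ratCast jbar _).symm
  have hδ : δ ∉ Set.range (algebraMap ℚ (AlgebraicClosure K)) :=
    not_mem_range_algebraMap_of_sq_eq_pStar hp hδ2
  -- the twisting transport, coefficients in `ℚ(δ)`
  obtain ⟨C₁, hC₁⟩ := W.exists_variableChange_quadraticTwist_one
  let T : GeomTransport W' W K := GeomTransport.ofQuadraticTwist W W' hC₁ hW hδ hδ2
  have hT : ∀ j, ∀ σ ∈ ringClassSubgroup K (p ^ (j + 1)) jbar,
      T.C.map (GeomTransport.galHom σ : AlgebraicClosure K →+* AlgebraicClosure K) = T.C :=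
    fun j σ hσ ↦ GeomTransport.ofQuadraticTwist_C_map_eq W W' hC₁ hW hδ hδ2
      (smul_eq_self_of_mem_ringClassSubgroup hK jbar (pow_ne_zero _ hp.ne_zero) hσ
        (apply_mem_ringClassField_pow_of_sq_eq_pStar hG hK hp2 hpd jbar hδ2 j))
  -- the norm points of the Heegner points of `E′`, transported
  have hz : ∀ j, ∃ z, IsTwistedHeegnerNormPoint N' W W' K κ Dt β T jbar j (p ^ (j + 1)) z := by
    intro j
    have hc : (p ^ (j + 1)).Coprime N' :=
      Nat.Coprime.pow_left _ (hp.coprime_iff_not_dvd.mpr hpN)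
    obtain ⟨-, x', R, hx', hfix, hRsub, htrans, -⟩ := hH hK hHN κ Dt hβ jbar j hc
    exact ⟨∑ r ∈ R, r • T.equiv x', x', R, hx', hfix,
      GeomTransport.smul_equiv_eq_self_of T (hT j) hfix, hRsub, htrans, rfl⟩
  choose z hz using hz
  exact ⟨δ, hδ, hδ2, C₁, hC₁, ⟨Dt, β, hβ, T, z, hz⟩, rfl, rfl, rfl⟩

/-- **… and the norm points of such a family are the transports of the `χ_{p*}`-twisted norms of
the Heegner points of `E′`**: `z_j = θ_C(∑_{r ∈ R_j} χ(r) r·P′[p^{j+1}])`, `χ = genusSign √p*` the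
quadratic character of `K(√p*)/K`, `R_j` a transversal of `Gal(K̄/K[p^{j+1}])` in `Gal(K̄/K_j)` —
Keller–Yin's «these images are nothing but the `z_{f,𝒪}` in [CastellaHsieh] where their `χ` is our
`χ_ε`» (proof of Thm. 3.3.5) read at Case (I) for an elliptic curve, now with BOTH the existence and
the `χ_ε`-dictionary kernel-checked (conditional on the two refereed facts only).
[cite: CastellaHsieh2018, §4.4 (the χ-components z_{f,χ,c} of the Heegner classes)]
[cite: SilvermanAEC2009, X.2 Example 2.4 (ξ_σ = [χ(σ)])] -/
theorem exists_twistedHeegnerFamily_z_eq_equiv_sum_genusSign_smul [W'.IsElliptic]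
    (hH : exists_isHeegnerNormPoint N' W' K p) (hG : sqrt_pStar_mem_ringClassField)
    (hK : IsImaginaryQuadratic K) (hHN : SatisfiesHeegnerHypothesis N' K) (hpN : ¬ p ∣ N')
    (hp2 : p ≠ 2) (hpd : ¬ (p : ℤ) ∣ NumberField.discr K) {C₀ : VariableChange ℚ}
    (hW : C₀ • W.quadraticTwist ((-1 : ℚ) ^ (p / 2) * p) = W') (κ : ZpExtension K p)
    (Dt : ModularParametrizationData W' N') {β : ℤ}
    (hβ : (4 * N' : ℤ) ∣ β ^ 2 - NumberField.discr K) (jbar : AlgebraicClosure K →+* ℂ) :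
    ∃ (δ : AlgebraicClosure K) (_ : δ ^ 2 = algebraMap ℚ (AlgebraicClosure K) ((-1 : ℚ) ^ (p / 2) * p))
      (F : TwistedHeegnerFamily N' W W' K κ jbar), F.Dt = Dt ∧ F.β = β ∧
      ∀ j, ∃ (x' : geomPoints (W'.baseChange K)) (R : Finset (Field.absoluteGaloisGroup K)),
        IsHeegnerGeomPoint N' W' K F.Dt F.β (p ^ (j + 1)) jbar x' ∧
        (∀ σ ∈ ringClassSubgroup K (p ^ (j + 1)) jbar, σ • x' = x') ∧
        (↑R ⊆ (κ.layerSubgroup j : Set (Field.absoluteGaloisGroup K))) ∧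
        (∀ τ ∈ κ.layerSubgroup j, ∃! r, r ∈ R ∧ r⁻¹ * τ ∈ ringClassSubgroup K (p ^ (j + 1)) jbar) ∧
        F.z j = F.T.equiv
          (∑ r ∈ R, ((genusSign δ (Field.absoluteGaloisGroup.toAlgEquiv K r) : ℤˣ) : ℤ) •
            (r • x')) := by
  obtain ⟨δ, hδ, hδ2, C₁, hC₁, F, hDt, hβ', hT⟩ :=
    exists_twistedHeegnerFamily_T_eq_ofQuadraticTwist hH hG hK hHN hpN hp2 hpd hW κ Dt hβ jbar
  exact ⟨δ, hδ2, F, hDt, hβ', fun j ↦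
    TwistedHeegnerFamily.exists_z_eq_equiv_sum_genusSign_smul W W' hC₁ hW hδ hδ2 F hT j⟩

end ExistenceSign

end Literature.NumberTheory.EllipticCurves

end
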